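import Literature.MathematicalPhysics.KineticTheory.InfiniteChainLightConeProofs
import Mathlib.Topology.Algebra.Order.Floor
import HarnessLib

/-!
# Abstract lattice iteration with a boundary source (light cone of a boundary perturbation)

Helper file (`--supports stmt-AtomisticToContinuum-12240`, item `HalfChainLocality` of route
`BoundaryEscapeDeficit`, sub-problem `FouriersLaw`). The deterministic core of finite-time locality of
the nearest-neighbour chain dynamics seen from the LEFT end: nonnegative continuous deviations
`w_k(τ)`, `k < ℓ`, on `[0, t]` (think: nonnegative, vanishing at `τ = 0`), obeying the first-order lattice inequalities

  `w_k(τ) ≤ a ∫₀^τ (w_{k-1} + w_k + w_{k+1}) ds`   (`k < ℓ`, with `w_{-1} := 0` and `w_ℓ := S`),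

i.e. driven only through the boundary site `ℓ` by a source of size `S`, satisfy the time-ordered
(Dyson / Dobrushin–Fritz / Lanford–Lebowitz–Lieb) bound

  `w_k(τ) ≤ S (3aτ)^{ℓ-k} e^{3aτ} / (ℓ-k)!`,

super-exponentially small in the distance `ℓ - k` to the source. Proof: the standard iteration
`w_k ≤ S Σ_{m=ℓ-k}^{n-1} (3aτ)^m/m! + B (3aτ)ⁿ/n!` by induction on `n` (`B` an a priori bound, e.g.
from continuity on the compact time interval), then `n → ∞`.

* `sum_Ico_pow_div_factorial_le` — `Σ_{m=d}^{n-1} x^m/m! ≤ x^d e^x / d!` (`x ≥ 0`);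
* `boundary_lattice_iteration_step` — the iteration;
* `boundary_lattice_iteration` (**main**) — the displayed bound.

Folklore (cf. Buttà–Marchioro 2016 §4 (4.3)–(4.9), whose single-site-perturbation version is the
tree's `BMLightCone.lattice_iteration`); no definitions.
-/

noncomputable section

open MeasureTheory Set Filter Topology Finset
open scoped BigOperators

namespace Summit.AtomisticToContinuum.FouriersLaw.Theorems.HalfChainLocality

open Literature.MathematicalPhysics.KineticTheory.HeatConduction

/-! ### The exponential tail of the time-ordered series -/

/-- `(d + j)! ≥ d! j!`, real form: `x^{d+j}/(d+j)! ≤ (x^d/d!)(x^j/j!)` for `x ≥ 0`. [folklore] -/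
theorem pow_add_div_factorial_le {x : ℝ} (hx : 0 ≤ x) (d j : ℕ) :
    x ^ (d + j) / ((d + j).factorial : ℝ) ≤ x ^ d / (d.factorial : ℝ) * (x ^ j / (j.factorial : ℝ)) := by
  rw [div_mul_div_comm, ← pow_add]
  apply div_le_div_of_nonneg_left (pow_nonneg hx _) (by positivity)
  exact_mod_cast Nat.le_of_dvd (Nat.factorial_pos _) (Nat.factorial_mul_factorial_dvd_factorial_add d j)

/-- **Tail of the exponential series from `d` on**: `Σ_{m ∈ [d, n)} x^m/m! ≤ (x^d/d!) e^x` for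
`x ≥ 0`. [folklore] -/
theorem sum_Ico_pow_div_factorial_le {x : ℝ} (hx : 0 ≤ x) (d n : ℕ) :
    ∑ m ∈ Finset.Ico d n, x ^ m / (m.factorial : ℝ) ≤ x ^ d / (d.factorial : ℝ) * Real.exp x := by
  rcases le_or_gt n d with hnd | hnd
  · rw [Finset.Ico_eq_empty_of_le hnd, Finset.sum_empty]
    positivity
  · rw [Finset.sum_Ico_eq_sum_range]
    calc ∑ j ∈ Finset.range (n - d), x ^ (d + j) / ((d + j).factorial : ℝ)
        ≤ ∑ j ∈ Finset.range (n - d), x ^ d / (d.factorial : ℝ) * (x ^ j / (j.factorial : ℝ)) :=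
          Finset.sum_le_sum fun j _ => pow_add_div_factorial_le hx d j
      _ = x ^ d / (d.factorial : ℝ) * ∑ j ∈ Finset.range (n - d), x ^ j / (j.factorial : ℝ) := by
          rw [Finset.mul_sum]
      _ ≤ x ^ d / (d.factorial : ℝ) * Real.exp x :=
          mul_le_mul_of_nonneg_left (Real.sum_le_exp_of_nonneg hx _) (by positivity)

/-! ### The iteration -/

variable {ℓ : ℕ} {t a S B : ℝ} {w : ℕ → ℝ → ℝ}

/-- **One sweep of the boundary-source iteration.** Under the hypotheses of
`boundary_lattice_iteration`, for every `n`: `w_k(τ) ≤ S Σ_{m ∈ [ℓ-k, n)} (3aτ)^m/m! + B (3aτ)ⁿ/n!`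
for all `k < ℓ`, `τ ∈ [0, t]`. [folklore] -/
theorem boundary_lattice_iteration_step (ha : 0 ≤ a) (hS : 0 ≤ S) (hSB : S ≤ B)
    (hw_cont : ∀ k, k < ℓ → ContinuousOn (w k) (Icc 0 t))
    (hw_bd : ∀ k, k < ℓ → ∀ s ∈ Icc 0 t, w k s ≤ B)
    (hw_int : ∀ k, k < ℓ → ∀ τ ∈ Icc 0 t, w k τ ≤ a * ∫ s in (0:ℝ)..τ,
        ((if k = 0 then 0 else w (k - 1) s) + w k s + (if k + 1 < ℓ then w (k + 1) s else S)))
    (n : ℕ) : ∀ k, k < ℓ → ∀ τ ∈ Icc 0 t,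
      w k τ ≤ S * ∑ m ∈ Finset.Ico (ℓ - k) n, (3 * a * τ) ^ m / (m.factorial : ℝ) +
        B * ((3 * a * τ) ^ n / (n.factorial : ℝ)) := by
  induction n with
  | zero =>
    intro k hk τ hτ
    rw [Finset.Ico_eq_empty_of_le (Nat.zero_le _), Finset.sum_empty, mul_zero, zero_add, pow_zero,
      Nat.factorial_zero, Nat.cast_one, div_one, mul_one]
    exact hw_bd k hk τ hτ
  | succ n ih =>
    intro k hk τ hτ
    obtain ⟨hτ0, hτt⟩ := hτ
    have hB : 0 ≤ B := hS.trans hSB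
    -- the common bound for the three neighbours on `[0, τ]`
    set g : ℝ → ℝ := fun s => S * ∑ m ∈ Finset.Ico (ℓ - k - 1) n, (3 * a * s) ^ m / (m.factorial : ℝ) +
      B * ((3 * a * s) ^ n / (n.factorial : ℝ)) with hg
    have hgcont : Continuous g := by
      simp only [hg]
      fun_prop
    have hterm_nn : ∀ (m : ℕ) {s : ℝ}, 0 ≤ s → 0 ≤ (3 * a * s) ^ m / (m.factorial : ℝ) :=
      fun m s hs => by positivity
    have hg_nn : ∀ {s : ℝ}, 0 ≤ s → 0 ≤ g s := fun {s} hs => by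
      simp only [hg]
      exact add_nonneg (mul_nonneg hS (Finset.sum_nonneg fun m _ => hterm_nn m hs))
        (mul_nonneg hB (hterm_nn n hs))
    -- a site `j < ℓ` with `ℓ - j ≥ ℓ - k - 1` is bounded by `g`
    have hsite : ∀ j, j < ℓ → ℓ - k - 1 ≤ ℓ - j → ∀ s ∈ Icc 0 τ, w j s ≤ g s := by
      intro j hj hkj s hs
      have hst : s ∈ Icc 0 t := ⟨hs.1, hs.2.trans hτt⟩
      refine (ih j hj s hst).trans ?_
      simp only [hg]
      refine add_le_add (mul_le_mul_of_nonneg_left ?_ hS) le_rfl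
      exact Finset.sum_le_sum_of_subset_of_nonneg (Finset.Ico_subset_Ico hkj le_rfl)
        fun m _ _ => hterm_nn m hs.1
    -- the boundary value `S` is bounded by `g` (`ℓ - k - 1 = 0` there)
    have hbdry : k + 1 = ℓ → ∀ s ∈ Icc 0 τ, S ≤ g s := by
      intro hkℓ s hs
      have h0 : ℓ - k - 1 = 0 := by omega
      simp only [hg, h0]
      rcases Nat.eq_zero_or_pos n with rfl | hn
      · simp only [Finset.Ico_self, Finset.sum_empty, mul_zero, zero_add, pow_zero, Nat.factorial_zero,
          Nat.cast_one, div_one, mul_one]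
        exact hSB
      · have h1 : (1 : ℝ) ≤ ∑ m ∈ Finset.Ico 0 n, (3 * a * s) ^ m / (m.factorial : ℝ) := by
          rw [Finset.sum_eq_sum_Ico_succ_bot hn]
          simp only [pow_zero, Nat.factorial_zero, Nat.cast_one, div_one]
          linarith [Finset.sum_nonneg fun m (_ : m ∈ Finset.Ico (0 + 1) n) => hterm_nn m hs.1]
        nlinarith [mul_nonneg hB (hterm_nn n hs.1)]
    -- pointwise bound of the integrand by `3 g`
    have hptw : ∀ s ∈ Icc 0 τ,
        (if k = 0 then 0 else w (k - 1) s) + w k s + (if k + 1 < ℓ then w (k + 1) s else S) ≤ 3 * g s := by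
      intro s hs
      have h2 : w k s ≤ g s := hsite k hk (by omega) s hs
      have h1 : (if k = 0 then 0 else w (k - 1) s) ≤ g s := by
        split_ifs with hk0
        · exact hg_nn hs.1
        · exact hsite (k - 1) (by omega) (by omega) s hs
      have h3 : (if k + 1 < ℓ then w (k + 1) s else S) ≤ g s := by
        split_ifs with hk1
        · exact hsite (k + 1) hk1 (by omega) s hs
        · exact hbdry (by omega) s hs
      linarith
    -- integrability
    have hcw : ∀ j, j < ℓ → ContinuousOn (w j) (Icc 0 τ) := fun j hj =>
      (hw_cont j hj).mono (Icc_subset_Icc le_rfl hτt)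
    have hintL : IntervalIntegrable (fun s => if k = 0 then (0:ℝ) else w (k - 1) s) volume 0 τ := by
      split_ifs with hk0
      · exact intervalIntegrable_const
      · apply ContinuousOn.intervalIntegrable
        rw [uIcc_of_le hτ0]
        exact hcw (k - 1) (by omega)
    have hintM : IntervalIntegrable (w k) volume 0 τ := by
      apply ContinuousOn.intervalIntegrable
      rw [uIcc_of_le hτ0]
      exact hcw k hk
    have hintR : IntervalIntegrable (fun s => if k + 1 < ℓ then w (k + 1) s else S) volume 0 τ := by
      split_ifs with hk1
      · apply ContinuousOn.intervalIntegrable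
        rw [uIcc_of_le hτ0]
        exact hcw (k + 1) hk1
      · exact intervalIntegrable_const
    have hmono : ∫ s in (0:ℝ)..τ,
        ((if k = 0 then 0 else w (k - 1) s) + w k s + (if k + 1 < ℓ then w (k + 1) s else S)) ≤
        ∫ s in (0:ℝ)..τ, 3 * g s :=
      intervalIntegral.integral_mono_on hτ0 ((hintL.add hintM).add hintR)
        ((hgcont.const_mul 3).intervalIntegrable _ _) hptw
    -- the integral of the bound
    have hti : ∀ m : ℕ, IntervalIntegrable (fun s : ℝ => (3 * a * s) ^ m / (m.factorial : ℝ)) volume 0 τ :=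
      fun m => (by fun_prop : Continuous fun s : ℝ => (3 * a * s) ^ m / (m.factorial : ℝ)).intervalIntegrable _ _
    have hgint : ∫ s in (0:ℝ)..τ, 3 * g s =
        3 * (S * ∑ m ∈ Finset.Ico (ℓ - k - 1) n, (3 * a) ^ m * τ ^ (m + 1) / ((m + 1 : ℝ) * m.factorial) +
          B * ((3 * a) ^ n * τ ^ (n + 1) / ((n + 1 : ℝ) * n.factorial))) := by
      rw [intervalIntegral.integral_const_mul]
      congr 1
      have hsi : IntervalIntegrable (fun s : ℝ => S * ∑ m ∈ Finset.Ico (ℓ - k - 1) n,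
          (3 * a * s) ^ m / (m.factorial : ℝ)) volume 0 τ :=
        (by fun_prop : Continuous fun s : ℝ => S * ∑ m ∈ Finset.Ico (ℓ - k - 1) n,
          (3 * a * s) ^ m / (m.factorial : ℝ)).intervalIntegrable _ _
      have hri : IntervalIntegrable (fun s : ℝ => B * ((3 * a * s) ^ n / (n.factorial : ℝ))) volume 0 τ :=
        (hti n).const_mul B
      simp only [hg]
      rw [intervalIntegral.integral_add hsi hri, intervalIntegral.integral_const_mul,
        intervalIntegral.integral_const_mul, intervalIntegral.integral_finsetSum (fun m _ => hti m)]
      have e1 : ∀ m : ℕ, ∫ s in (0:ℝ)..τ, (3 * a * s) ^ m / (m.factorial : ℝ) =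
          (3 * a) ^ m * τ ^ (m + 1) / ((m + 1 : ℝ) * m.factorial) := fun m => by
        have h := BMLightCone.integral_iterTerm (3 * a) m τ
        simpa using h
      rw [e1 n, Finset.sum_congr rfl fun m _ => e1 m]
    -- `3a · (3a)^m τ^{m+1}/((m+1) m!) = (3aτ)^{m+1}/(m+1)!`
    have hkey : ∀ m : ℕ, a * (3 * ((3 * a) ^ m * τ ^ (m + 1) / ((m + 1 : ℝ) * m.factorial))) =
        (3 * a * τ) ^ (m + 1) / ((m + 1).factorial : ℝ) := by
      intro m
      rw [Nat.factorial_succ]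
      push_cast
      have hm : ((m : ℝ) + 1) ≠ 0 := by positivity
      have hf : (m.factorial : ℝ) ≠ 0 := by positivity
      field_simp
      ring
    -- assemble
    have hstep := hw_int k hk τ ⟨hτ0, hτt⟩
    have hmain : w k τ ≤ S * ∑ m ∈ Finset.Ico (ℓ - k - 1) n, (3 * a * τ) ^ (m + 1) / ((m + 1).factorial : ℝ) +
        B * ((3 * a * τ) ^ (n + 1) / ((n + 1).factorial : ℝ)) := by
      refine hstep.trans ?_
      refine (mul_le_mul_of_nonneg_left (hmono.trans_eq hgint) ha).trans (le_of_eq ?_)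
      rw [← hkey n, ← Finset.sum_congr rfl fun m _ => hkey m]
      simp only [Finset.mul_sum, mul_add]
      congr 1
      · exact Finset.sum_congr rfl fun m _ => by ring
      · ring
    -- reindex `m ↦ m + 1`: `Ico (ℓ-k-1) n ↦ Ico (ℓ-k) (n+1)`
    have hreindex : ∑ m ∈ Finset.Ico (ℓ - k - 1) n, (3 * a * τ) ^ (m + 1) / ((m + 1).factorial : ℝ) =
        ∑ m ∈ Finset.Ico (ℓ - k - 1 + 1) (n + 1), (3 * a * τ) ^ m / (m.factorial : ℝ) := by
      rw [← Finset.sum_Ico_add' (fun m : ℕ => (3 * a * τ) ^ m / (m.factorial : ℝ))]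
    rw [hreindex, show ℓ - k - 1 + 1 = ℓ - k by omega] at hmain
    exact hmain

/-- **Light cone of a boundary source (abstract lattice iteration).** Let `a, S ≥ 0`, `S ≤ B`, and let
`w_k`, `k < ℓ`, be continuous on `[0, t]` with `w_k ≤ B` there and
`w_k(τ) ≤ a ∫₀^τ (w_{k-1} + w_k + w_{k+1}) ds` for `τ ∈ [0,t]` (conventions `w_{-1} = 0`, `w_ℓ = S`).
Then `w_k(τ) ≤ S · (3aτ)^{ℓ-k}/(ℓ-k)! · e^{3aτ}` for all `k < ℓ`, `τ ∈ [0,t]`: a perturbation entering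
only through the boundary site `ℓ` reaches site `k` within time `τ` with a weight that is
super-exponentially small in `ℓ - k`. [folklore] -/
theorem boundary_lattice_iteration (ha : 0 ≤ a) (hS : 0 ≤ S) (hSB : S ≤ B)
    (hw_cont : ∀ k, k < ℓ → ContinuousOn (w k) (Icc 0 t))
    (hw_bd : ∀ k, k < ℓ → ∀ s ∈ Icc 0 t, w k s ≤ B)
    (hw_int : ∀ k, k < ℓ → ∀ τ ∈ Icc 0 t, w k τ ≤ a * ∫ s in (0:ℝ)..τ,
        ((if k = 0 then 0 else w (k - 1) s) + w k s + (if k + 1 < ℓ then w (k + 1) s else S)))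
    (k : ℕ) (hk : k < ℓ) (τ : ℝ) (hτ : τ ∈ Icc 0 t) :
    w k τ ≤ S * ((3 * a * τ) ^ (ℓ - k) / ((ℓ - k).factorial : ℝ)) * Real.exp (3 * a * τ) := by
  have hx : 0 ≤ 3 * a * τ := by have := hτ.1; positivity
  set C : ℝ := S * ((3 * a * τ) ^ (ℓ - k) / ((ℓ - k).factorial : ℝ)) * Real.exp (3 * a * τ) with hC
  -- for every `n`: `w_k(τ) ≤ C + B (3aτ)ⁿ/n!`
  have hn : ∀ n : ℕ, w k τ ≤ C + B * ((3 * a * τ) ^ n / (n.factorial : ℝ)) := by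
    intro n
    refine (boundary_lattice_iteration_step ha hS hSB hw_cont hw_bd hw_int n k hk τ hτ).trans ?_
    refine add_le_add ?_ le_rfl
    rw [hC, mul_assoc S]
    exact mul_le_mul_of_nonneg_left (sum_Ico_pow_div_factorial_le hx _ _) hS
  -- `n → ∞`
  have hlim : Tendsto (fun n : ℕ => C + B * ((3 * a * τ) ^ n / (n.factorial : ℝ))) atTop (𝓝 (C + B * 0)) :=
    tendsto_const_nhds.add ((FloorSemiring.tendsto_pow_div_factorial_atTop (3 * a * τ)).const_mul B)
  rw [mul_zero, add_zero] at hlim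
  exact ge_of_tendsto' hlim hn

end Summit.AtomisticToContinuum.FouriersLaw.Theorems.HalfChainLocality

end
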